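import Summits.AnomalousDissipation.AnomalousDissipation.Theses.TwoAndHalfD
import Literature.Analysis.FluidPDE.TorusClassicalLerayHopfProofs
import Literature.Barriers.AnomalousDissipation.GravestModeLaminarAttractorSwept
import Summits.AnomalousDissipation.AnomalousDissipation.Theorems.ScalarAnomalySteadySourceFormal.Negative.ForcedClassicalWeak
import Summits.AnomalousDissipation.AnomalousDissipation.Theorems.TwoAndHalfDScalarAnomalySteadySourceFormalColdStartVarianceToolkit
import Summits.AnomalousDissipation.AnomalousDissipation.Theorems.TwoAndHalfDScalarAnomalySteadySourceFormalColdStartVariance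
import Summits.AnomalousDissipation.AnomalousDissipation.Theorems.TwoAndHalfDScalarAnomalySteadySourceFormalDissipationFromPower
import Summits.AnomalousDissipation.AnomalousDissipation.Theorems.TwoAndHalfDScalarAnomalySteadySourceFormalDuhamelMajorant

/-!
# The profile-mixer transfer: `ScalarAnomalySteadySourceFormal` from a release majorant on the planar NS family

Line `budgeted-mixer-template` (reshape r1) for the crux
`Summit.AnomalousDissipation.AnomalousDissipation.Theses.TwoAndHalfD.ScalarAnomalySteadySourceFormal`
(stmt-AnomalousDissipation-0448). This file is the line's skeleton CLOSED MODULO ITS RESIDUAL STUB S1'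
(`stub_profileMixerRealizable`, open): the kernel-checked TRANSFER
`stub_profileMixerTransfer : (S1' body) → ScalarAnomalySteadySourceFormal` (registered sub-goal of the
crux item), so that any future witness of the profile-wise mixing spec closes the crux in one line.

CONTENT. The spec (hypothesis of `stub_profileMixerTransfer`): a smooth divergence-free mean-zero steady
planar force `g`, a smooth mean-zero profile `h`, viscosities `ν_j → 0`, classical Navier–Stokes solutions
`(v_j, p_j)` on `T² × [0, ∞)` forced by `g` with pointwise bounded energy, an antitone majorant `ρm ≥ 0` with
`∫₀ᵗ ρm ≤ R`, a lag `L > 0` and a floor `c₀ > 0` with the tail coupling `‖h‖² ∫_L^t ρm ≤ c₀/2`, such that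
(Decay) every classical release of `h` into `v_j` from any start time `s ≥ 0` decays in `L²` under `ρm(· - s)`
and (Floor) every classical cold start of the `h`-sourced problem over `[s, s + L]` has input power `≥ c₀` at
its end. The transfer: global cold starts `θ_j` exist (`ColdStartVariance.exists_global_coldStart`); the
Duhamel majorant (`DuhamelMajorant.stub_duhamelMajorant`, S5) bounds their variance by `R²‖h‖²`
(`coldStart_variance_le`) and, with (Floor) and Cauchy–Schwarz, floors their input power by `c₀/2` after
the lag (`coldStart_power_ge`); power = dissipation in the mean (`DissipationFromPower.stub_dissipationFromPower`,
S4) gives the anomaly `⟨ν_j‖∇θ_j‖²⟩ ≥ c₀/2`; classical NS ⇒ global Leray–Hopf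
(`IsClassicalNSSolutionOn.isLerayHopfOn_of_convex`), classical ⇒ weak sourced
(`Negative.isWeakScalarTransportForcedOn_of_classical`), pointwise ⇒ limsup-mean bounds.

Supports stmt-AnomalousDissipation-0448 (registered sub-goal `stub_profileMixerTransfer`). [folklore]
-/

-- the summit path `AnomalousDissipation/AnomalousDissipation` duplicates a namespace component
set_option linter.dupNamespace false

noncomputable section

namespace Summit.AnomalousDissipation.AnomalousDissipation.Theorems.ScalarAnomalySteadySourceFormal.ProfileMixerTransfer

open MeasureTheory Filter Topology Set
open scoped ENNReal NNReal
open Literature.Analysis.FunctionSpaces Literature.Analysis.FluidPDE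
open Summit.AnomalousDissipation.AnomalousDissipation.Theorems.ScalarAnomalySteadySourceFormal

section Transfer

variable {κ : ℝ} {W : ℝ → UnitAddTorus (Fin 2) → EuclideanSpace ℝ (Fin 2)} {h : UnitAddTorus (Fin 2) → ℝ}
  {ρm : ℝ → ℝ} {θ : ℝ → UnitAddTorus (Fin 2) → ℝ}

/-- **S2' — the cold-start variance bound from the Duhamel majorant.** Over a jointly smooth
divergence-free drift `W` on `T² × [0, ∞)` (`κ > 0`) whose releases of the smooth profile `h` decay under the
antitone majorant `ρm ≥ 0` with `∫₀ᵗ ρm ≤ R` (`t ≥ 0`), the global cold start `θ` (`θ(0) = 0`) of the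
`h`-sourced equation has `‖θ(t)‖²_{L²} ≤ R² ‖h‖²_{L²}` for all `t ≥ 0` (S5 with `a = 0`, `b = t`, read at
the initial time of any release window `[t, t + 1]`; `∫₀ᵗ ρm(t - r) dr = ∫₀ᵗ ρm`). [folklore] -/
theorem coldStart_variance_le (hκ : 0 < κ) (hW : Torus.IsSmoothSpaceTimeOn (Set.Ici 0) W)
    (hdiv : ∀ t ∈ Set.Ici (0 : ℝ), Torus.IsDivFree (W t)) (hh : Torus.IsSmooth h)
    (hanti : Antitone ρm) (hnonneg : ∀ r, 0 ≤ ρm r)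
    (hdecay : ∀ (s T' : ℝ), 0 ≤ s → ∀ φ : ℝ → UnitAddTorus (Fin 2) → ℝ,
      Torus.IsClassicalScalarTransportOn (Set.Icc s T') κ W φ → φ s = h →
      ∀ t ∈ Set.Icc s T', Torus.scalarL2Sq (φ t) ≤ ρm (t - s) ^ 2 * Torus.scalarL2Sq h)
    {R : ℝ} (hR : ∀ t, 0 ≤ t → ∫ r in (0 : ℝ)..t, ρm r ≤ R)
    (hθ : Torus.IsClassicalScalarTransportForcedOn (Set.Ici 0) κ W (fun _ => h) θ)
    (hθ0 : θ 0 = fun _ => (0 : ℝ)) {t : ℝ} (ht : 0 ≤ t) :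
    Torus.scalarL2Sq (θ t) ≤ R ^ 2 * Torus.scalarL2Sq h := by
  rcases eq_or_lt_of_le ht with rfl | ht'
  · rw [hθ0]
    simp only [Torus.scalarL2Sq, ne_eq, OfNat.ofNat_ne_zero, not_false_eq_true, zero_pow,
      integral_zero]
    exact mul_nonneg (sq_nonneg _) (Torus.scalarL2Sq_nonneg _)
  -- restrict the cold start to `[0, t]` and release its final state on `[t, t + 1]`
  have hθ' := ColdStartVariance.forced_restrict hθ Set.Icc_subset_Ici_self (uniqueDiffOn_Icc ht')
  have hθt : Torus.IsSmooth (θ t) := hθ.smooth_scalar.isSmooth_slice (show (0 : ℝ) ≤ t from ht)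
  obtain ⟨ψ, hψ, hψt⟩ := ColdStartVariance.exists_release hκ one_pos hW hdiv ht hθt
  have hS5 := DuhamelMajorant.stub_duhamelMajorant κ W h ρm hκ hW hdiv hh hanti hnonneg hdecay
    0 t (t + 1) θ ψ le_rfl ht' (lt_add_one t) hθ' hθ0 hψ hψt t
    (Set.left_mem_Icc.2 (lt_add_one t).le)
  rw [hψt, intervalIntegral.integral_comp_sub_left (fun r => ρm r) t] at hS5
  simp only [sub_self, sub_zero] at hS5
  have hint : ∫ r in (0 : ℝ)..t, ρm r ≤ R := hR t ht
  have hsq : 0 ≤ Real.sqrt (Torus.scalarL2Sq h) := Real.sqrt_nonneg _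
  have h1 : Real.sqrt (Torus.scalarL2Sq (θ t)) ≤ Real.sqrt (Torus.scalarL2Sq h) * R :=
    hS5.trans (mul_le_mul_of_nonneg_left hint hsq)
  have h0 : 0 ≤ Real.sqrt (Torus.scalarL2Sq (θ t)) := Real.sqrt_nonneg _
  calc Torus.scalarL2Sq (θ t) = (Real.sqrt (Torus.scalarL2Sq (θ t))) ^ 2 :=
        (Real.sq_sqrt (Torus.scalarL2Sq_nonneg _)).symm
    _ ≤ (Real.sqrt (Torus.scalarL2Sq h) * R) ^ 2 := by gcongr
    _ = R ^ 2 * Torus.scalarL2Sq h := by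
        rw [mul_pow, Real.sq_sqrt (Torus.scalarL2Sq_nonneg _)]; ring

/-- **S3' — the eventual input-power floor from the Duhamel majorant.** Under the hypotheses of
`coldStart_variance_le` together with the cold-start floor `c₀` at lag `L > 0` (any start time) and the tail
coupling `‖h‖² ∫_L^t ρm ≤ c₀/2` (`t ≥ L`), the global cold start has `∫ h·θ(t) ≥ c₀/2` for all `t ≥ L`:
split `θ(t) = ψ(t) + ρ'(t)` on `[t - L, t]` with `ψ` the release of `θ(t - L)` and `ρ'` the cold start at
`t - L`; (Floor) bounds `∫ h ρ'(t)` below by `c₀`, S5 (`a = 0`, `b = t - L`) and Cauchy–Schwarz bound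
`|∫ h ψ(t)| ≤ ‖h‖² ∫_L^t ρm ≤ c₀/2`. [folklore: Green–Kubo tail] -/
theorem coldStart_power_ge (hκ : 0 < κ) (hW : Torus.IsSmoothSpaceTimeOn (Set.Ici 0) W)
    (hdiv : ∀ t ∈ Set.Ici (0 : ℝ), Torus.IsDivFree (W t)) (hh : Torus.IsSmooth h)
    (hanti : Antitone ρm) (hnonneg : ∀ r, 0 ≤ ρm r)
    (hdecay : ∀ (s T' : ℝ), 0 ≤ s → ∀ φ : ℝ → UnitAddTorus (Fin 2) → ℝ,
      Torus.IsClassicalScalarTransportOn (Set.Icc s T') κ W φ → φ s = h →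
      ∀ t ∈ Set.Icc s T', Torus.scalarL2Sq (φ t) ≤ ρm (t - s) ^ 2 * Torus.scalarL2Sq h)
    {L c₀ : ℝ} (hL : 0 < L)
    (hsmall : ∀ t, L ≤ t → Torus.scalarL2Sq h * ∫ r in L..t, ρm r ≤ c₀ / 2) (hc₀ : 0 < c₀)
    (hfloor : ∀ (s : ℝ), 0 ≤ s → ∀ θ' : ℝ → UnitAddTorus (Fin 2) → ℝ,
      Torus.IsClassicalScalarTransportForcedOn (Set.Icc s (s + L)) κ W (fun _ => h) θ' →
      θ' s = (fun _ => (0 : ℝ)) → c₀ ≤ ∫ x, h x * θ' (s + L) x)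
    (hθ : Torus.IsClassicalScalarTransportForcedOn (Set.Ici 0) κ W (fun _ => h) θ)
    (hθ0 : θ 0 = fun _ => (0 : ℝ)) {t : ℝ} (ht : L ≤ t) :
    c₀ / 2 ≤ ∫ x, h x * θ t x := by
  rcases eq_or_lt_of_le ht with rfl | ht'
  · -- `t = L`: the global cold start restricted to `[0, L]` IS a cold start at `s = 0`
    have hθ' := ColdStartVariance.forced_restrict hθ Set.Icc_subset_Ici_self (uniqueDiffOn_Icc hL)
    have := hfloor 0 le_rfl θ (by simpa using hθ') hθ0
    simp only [zero_add] at this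
    linarith
  -- `t > L`: restart at `s = t - L > 0`
  set s := t - L with hs_def
  have hs0 : 0 < s := by rw [hs_def]; linarith
  have hsL : s + L = t := by rw [hs_def]; ring
  have hsub : Set.Icc s (s + L) ⊆ Set.Ici 0 := fun r hr => hs0.le.trans hr.1
  have hsl : s < s + L := by linarith
  have hθw := ColdStartVariance.forced_restrict hθ hsub (uniqueDiffOn_Icc hsl)
  have hθs : Torus.IsSmooth (θ s) := hθ.smooth_scalar.isSmooth_slice (show (0 : ℝ) ≤ s from hs0.le)
  obtain ⟨ψ, hψ, hψs⟩ := ColdStartVariance.exists_release hκ hL hW hdiv hs0.le hθs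
  -- the cold start at `s`
  have hρ := ColdStartVariance.forced_sub_unforced (uniqueDiffOn_Icc hsl) hθw hψ
  have hρ0 : (fun r x => θ r x - ψ r x) s = fun _ => 0 := by
    funext x; simp [hψs]
  have hfl := hfloor s hs0.le _ hρ hρ0
  rw [hsL] at hfl
  -- S5 on `[0, s]`, released on `[s, s + L]`, read at `t`
  have hθ0s := ColdStartVariance.forced_restrict hθ Set.Icc_subset_Ici_self (uniqueDiffOn_Icc hs0)
  have hS5 := DuhamelMajorant.stub_duhamelMajorant κ W h ρm hκ hW hdiv hh hanti hnonneg hdecay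
    0 s (s + L) θ ψ le_rfl hs0 hsl hθ0s hθ0 hψ hψs t (by rw [hsL]; exact ⟨by linarith, le_rfl⟩)
  rw [intervalIntegral.integral_comp_sub_left (fun r => ρm r) t] at hS5
  simp only [sub_zero] at hS5
  rw [show t - s = L by rw [hs_def]; ring] at hS5
  -- Cauchy–Schwarz for `∫ h ψ(t)`
  have hψt : Torus.IsSmooth (ψ t) :=
    hψ.smooth_scalar.isSmooth_slice (by rw [hsL]; exact ⟨by linarith, le_rfl⟩)
  have hcs := ColdStartVariance.integral_mul_le_sqrt_mul_sqrt (hh.memLp 2) (hψt.memLp 2)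
  have hcs' := ColdStartVariance.integral_mul_le_sqrt_mul_sqrt ((hh.neg).memLp 2) (hψt.memLp 2)
  have hint_nonneg : 0 ≤ ∫ r in L..t, ρm r :=
    intervalIntegral.integral_nonneg ht (fun r _ => hnonneg r)
  have hH : 0 ≤ Real.sqrt (Torus.scalarL2Sq h) := Real.sqrt_nonneg _
  have hbound : |∫ x, h x * ψ t x| ≤ Torus.scalarL2Sq h * ∫ r in L..t, ρm r := by
    have hsq : Real.sqrt (∫ x, h x ^ 2) * Real.sqrt (∫ x, ψ t x ^ 2) ≤
        Torus.scalarL2Sq h * ∫ r in L..t, ρm r := by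
      calc Real.sqrt (∫ x, h x ^ 2) * Real.sqrt (∫ x, ψ t x ^ 2)
          ≤ Real.sqrt (Torus.scalarL2Sq h) * (Real.sqrt (Torus.scalarL2Sq h) * ∫ r in L..t, ρm r) :=
            mul_le_mul_of_nonneg_left hS5 hH
        _ = Torus.scalarL2Sq h * ∫ r in L..t, ρm r := by
            rw [← mul_assoc, Real.mul_self_sqrt (Torus.scalarL2Sq_nonneg _)]
    rw [abs_le]
    constructor
    · have hneg : ∫ x, (-h x) * ψ t x ≤ Real.sqrt (∫ x, (-h x) ^ 2) * Real.sqrt (∫ x, ψ t x ^ 2) := hcs'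
      simp only [neg_mul, integral_neg, even_two, Even.neg_pow] at hneg
      linarith
    · exact hcs.trans hsq
  have hsm := hsmall t ht
  -- assemble: `∫ h θ(t) = ∫ h ψ(t) + ∫ h (θ - ψ)(t)`
  have hθt : Torus.IsSmooth (θ t) := hθ.smooth_scalar.isSmooth_slice (show (0 : ℝ) ≤ t by linarith)
  have hsplit : ∫ x, h x * θ t x = (∫ x, h x * ψ t x) + ∫ x, h x * (θ t x - ψ t x) := by
    have i1 : Integrable (fun x => h x * ψ t x) := (hh.smul' hψt).integrable
    have i2 : Integrable (fun x => h x * (θ t x - ψ t x)) := (hh.smul' (hθt.sub hψt)).integrable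
    rw [← integral_add i1 i2]
    congr 1; funext x; ring
  rw [hsplit]
  have := (abs_le.1 hbound).1
  linarith

end Transfer

/-- **The transfer `C⁺ ⇒ crux`** (registered sub-goal `stub_profileMixerTransfer` of
stmt-AnomalousDissipation-0448; the line's skeleton closed modulo its residual stub S1'
`stub_profileMixerRealizable`): the profile-wise mixing spec on a steadily forced classical planar
Navier–Stokes family implies `TwoAndHalfD.ScalarAnomalySteadySourceFormal`. Proof: global cold starts
`θ_j` (`ColdStartVariance.exists_global_coldStart`), variance `≤ R²‖h‖²` (`coldStart_variance_le`), input
power `≥ c₀/2` after the lag (`coldStart_power_ge`), anomaly by `DissipationFromPower.stub_dissipationFromPower`,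
then classical NS ⇒ global Leray–Hopf, classical ⇒ weak sourced, pointwise ⇒ limsup-mean bounds. [folklore] -/
theorem stub_profileMixerTransfer :
    (∃ (g : UnitAddTorus (Fin 2) → EuclideanSpace ℝ (Fin 2)) (h : UnitAddTorus (Fin 2) → ℝ),
      Torus.IsSmooth g ∧ Torus.IsDivFree g ∧ Torus.HasZeroMean g ∧
      Torus.IsSmooth h ∧ Torus.HasZeroMean h ∧
      ∃ (ν : ℕ → ℝ) (v : ℕ → ℝ → UnitAddTorus (Fin 2) → EuclideanSpace ℝ (Fin 2))
        (p : ℕ → ℝ → UnitAddTorus (Fin 2) → ℝ) (ρm : ℝ → ℝ) (E R L c₀ : ℝ),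
        (∀ j, 0 < ν j) ∧ Tendsto ν atTop (𝓝 0) ∧ 0 < L ∧ 0 < c₀ ∧
        Antitone ρm ∧ (∀ r, 0 ≤ ρm r) ∧ (∀ t, 0 ≤ t → ∫ r in (0 : ℝ)..t, ρm r ≤ R) ∧
        (∀ t, L ≤ t → Torus.scalarL2Sq h * ∫ r in L..t, ρm r ≤ c₀ / 2) ∧
        (∀ j, Torus.IsClassicalNSSolutionOn (Set.Ici 0) (ν j) (fun _ => g) (v j) (p j)) ∧
        (∀ j t, 0 ≤ t → ∫ x, ‖v j t x‖ ^ 2 ≤ E) ∧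
        -- (Decay) releases of the profile `h` from any start time obey the majorant
        (∀ j (s T' : ℝ), 0 ≤ s → ∀ φ : ℝ → UnitAddTorus (Fin 2) → ℝ,
            Torus.IsClassicalScalarTransportOn (Set.Icc s T') (ν j) (v j) φ → φ s = h →
            ∀ t ∈ Set.Icc s T', Torus.scalarL2Sq (φ t) ≤ ρm (t - s) ^ 2 * Torus.scalarL2Sq h) ∧
        -- (Floor) cold-start input power at lag `L`, any start time
        (∀ j (s : ℝ), 0 ≤ s → ∀ θ' : ℝ → UnitAddTorus (Fin 2) → ℝ,
            Torus.IsClassicalScalarTransportForcedOn (Set.Icc s (s + L)) (ν j) (v j) (fun _ => h) θ' →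
            θ' s = (fun _ => (0 : ℝ)) → c₀ ≤ ∫ x, h x * θ' (s + L) x)) →
      Summit.AnomalousDissipation.AnomalousDissipation.Theses.TwoAndHalfD.ScalarAnomalySteadySourceFormal := by
  rintro ⟨g, h, hgs, hgd, hgm, hhs, hhm, ν, v, p, ρm, E, R, L, c₀, hν, hν0, hL, hc₀, hanti, hnn, hR,
    hsmall, hNS, hE, hDecay, hFloor⟩
  -- one global cold-start scalar per `j`
  have hex : ∀ j, ∃ θ : ℝ → UnitAddTorus (Fin 2) → ℝ,
      Torus.IsClassicalScalarTransportForcedOn (Set.Ici 0) (ν j) (v j) (fun _ => h) θ ∧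
      θ 0 = fun _ => (0 : ℝ) := fun j =>
    ColdStartVariance.exists_global_coldStart (hν j) (hNS j).smooth_velocity (hNS j).divFree hhs
  choose θ hθ hθ0 using hex
  -- S2': variance
  have hVar : ∀ j t, 0 ≤ t → Torus.scalarL2Sq (θ j t) ≤ R ^ 2 * Torus.scalarL2Sq h := fun j t ht =>
    coldStart_variance_le (hν j) (hNS j).smooth_velocity (hNS j).divFree hhs hanti hnn (hDecay j) hR
      (hθ j) (hθ0 j) ht
  -- S3': eventual input-power floor
  have hpow : ∀ j t, L ≤ t → c₀ / 2 ≤ ∫ x, h x * θ j t x := fun j t ht =>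
    coldStart_power_ge (hν j) (hNS j).smooth_velocity (hNS j).divFree hhs hanti hnn (hDecay j) hL hsmall
      hc₀ (hFloor j) (hθ j) (hθ0 j) ht
  -- S4: the dissipation floor
  have hflux : ∀ j, c₀ / 2 ≤
      longTimeAvgSup (fun t => ν j * (Torus.eScalarGradNormSq (θ j t)).toReal) := fun j =>
    DissipationFromPower.stub_dissipationFromPower (ν j) (R ^ 2 * Torus.scalarL2Sq h) (c₀ / 2) L (v j) h
      (θ j) (hν j).le (hθ j) (hVar j) (hpow j)
  refine ⟨g, h, hgs, hgd, hgm, hhs, hhm, ν, fun j => v j 0, v, fun j => θ j 0, θ, hν, hν0,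
    ?_, ?_, ?_, ?_, ?_, ?_⟩
  · -- classical NS on `[0, ∞)` ⇒ global Leray–Hopf with datum `v j 0`
    intro j T hT
    exact (hNS j).isLerayHopfOn_of_convex (convex_Ici 0) hT Set.Icc_subset_Ici_self
  · -- the zero datum is in `L²`
    intro j
    dsimp only
    rw [hθ0 j]
    exact memLp_const 0
  · -- classical cold start ⇒ global weak sourced solution
    intro j T hT
    exact Negative.isWeakScalarTransportForcedOn_of_classical (hθ j) Set.Icc_subset_Ici_self
  · -- pointwise energy bound ⇒ limsup-mean energy bound
    exact ⟨E, fun j => Literature.Barriers.AnomalousDissipation.meanEnergy_le_of_forall_le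
      fun t ht => hE j t ht.le⟩
  · -- pointwise variance bound ⇒ limsup-mean variance bound
    exact ⟨R ^ 2 * Torus.scalarL2Sq h, fun j =>
      Literature.Barriers.AnomalousDissipation.longTimeAvgSup_le_of_forall_le
        (fun t _ => Torus.scalarL2Sq_nonneg _) fun t ht => hVar j t ht.le⟩
  · -- the anomaly
    exact ⟨c₀ / 2, half_pos hc₀, hflux⟩

end Summit.AnomalousDissipation.AnomalousDissipation.Theorems.ScalarAnomalySteadySourceFormal.ProfileMixerTransfer

end
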